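import Summits.QuantumFields.YangMills.Theorems.BalabanUVNodesN15TwoSpacingGluingCubes
import HarnessLib

/-!
# THE WALK LOCALITY OF GLUED INVERSES ([B9] Cor. 3.8 ∕ Thm 3.14 MECHANISM): two resummed parametrix pairs `G = G₀(1 − R)⁻¹`, `G♭ = G₀♭(1 − R♭)⁻¹` whose pieces AGREE
# except on cubes reaching into a set `Z` differ, at outputs `y`, by `≤ C·e^{−(δ∕2−σ)·d_Z(y)}·e^{−(δ∕2−2σ)d(y,y′)}` — exponentially small in the distance from `y` to `Z`,
# with NO smallness of `G₀ − G₀♭`, `R − R♭` needed (dag-n15-c g27, n15-c∕279; N15 = NE2, s1 road (c), programme (PC))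

Cell `pub-ymgap`, seat `pub-ymgap-dag-n15-c` (generation g27; R134 (a), s1; HUMAN RULING D-0062).  `bears_on: R4∕N15 · K3⁸ SpineGivenEndpointR13SepCoPHV (stmt-QuantumFields-27366)`;
filed `--kind proof --supports stmt-QuantumFields-27366 --as helper` — COUNT-NEUTRAL.  Theorems only; 0 `def`, 0 `sorry`.  Imports BY NAME n15-c FILE 45 `…TwoSpacingGluingCubes`
(`parametrix`, `commOp`, `remainder`, `hasMaj_sum_overlap`, `hasMaj_fsum`; through it FILE 43 `…TwoSpacingGluing`: `neumannR`, `glueInv`, `one_sub_comp_neumannR`,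
`neumannR_comp_one_sub`, `isUnit_neumannR`, `hasMaj_neumannR`; lit `B11SectG` (`HasMaj`, `hasMaj_comp`, `hasMaj_comp_exp`, `conv_exp_le`, `RowSum`), lit `B6Prop26Gluing` (`ind`)).
Nothing in the tree is modified; nothing restated.

WHY (the located device of HOME HANDOFF § g26 «STATE OF THE PROGRAMME (PC)» (iv)∕(v) and § g25 «CORRECTION (2)»).  [Balaban1985BackgroundPropagators] p.410 (verbatim): *«A propagator
G′_□ depends on U restricted to Ω₂₀(□) ⊂ □̃, and the operator K(h) is semi-local, hence a term in (3.90) corresponding to a walk ω = (□₀, □₁, …, □_n) depends on U restricted to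
□̃₀ ∪ □̃₁ ∪ … ∪ □̃_n»*, and Cor. 3.8 (3.94): the term of the walk ω carries `e^{−δ₀d(ω,y,y′)}`.  This is the device by which Sect. C localises every operator: (3.95)'s middle sum
`h̃_□Q′(G′² − G′_□²)Q′*h_□C_□h_□` (Thm 3.2 ∕ 3.9 for `(Q′G′²Q′*)⁻¹`) and Thm 3.14 pp.426–427 («if we change the domains outside some region, changes in the operator are exponentially
small in the distance») are instances.  In the tree every glued propagator of the (PC) programme is `glueInv G₀ R = G₀∘(1 − R)⁻¹` (FILE 43) with `G₀ = Σ_□ P_□`, `R = Σ_□ Q_□` sums of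
cube-localized pieces (FILE 45, dag-n15-w3 52, n15-c∕262∕273): when two such operators are built from pieces that COINCIDE on every cube not reaching into `Z` (e.g. `G′(U)` and `G′(V)`
for bond fields `U = V` off `Z`, glued with the same gauges there), their difference is carried by walks through `Z`.  The resolvent-identity route (`G′(U) − G′(V) = G′(U)(Δ′_V −
Δ′_U)G′(V)`) is useless per cube — `Δ′_V − Δ′_U` is `O(η⁻²)` where no common small gauge exists — whereas HERE no difference of pieces is ever small: only BOUNDED (each piece by its own
row) and LOCALIZED.  THIS FILE is that bookkeeping, abstractly, for FILE 43's `glueInv`.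

WHAT (geometry `g` with `Triangle254`, `RowSum g σ c_r`; `Z : Set g.Site`; a MINORANT `d_Z` of the distance to `Z`: `∀ y, ∀ z ∈ Z, d_Z(y) ≤ d(y,z)` — e.g. `m·1_A` for a set `A` at distance
`≥ m` from `Z`, or `0`):
* §1 algebra: `neumannR_sub_neumannR` (`N − N♭ = N∘(R − R♭)∘N♭`), ★ `glueInv_sub_glueInv` (`G − G♭ = (G₀ − G₀♭)∘N + (G₀♭∘N)∘((R − R♭)∘N♭)`).
* §2 kernels: `exp_far_split` (`z ∈ Z ⟹ e^{−ρd(y,z)} ≤ e^{−(ρ∕2)d_Z(y)}·e^{−(ρ∕2)d(y,z)}`), `ind_le_exp_dZ` (`1_Z(y) ≤ e^{−c·d_Z(y)}`), ★★ `hasMaj_comp_farOut` (`T₁ ≤ a₁e^{−ρ₁d}`, `T₂ ≤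
  1_Z(y)·a₂e^{−ρ₂d}` ⟹ `T₁∘T₂ ≤ κa₁a₂c_r·e^{−(ρ₁∕2)d_Z(y)}·e^{−ρd}` for `ρ ≤ ρ₂`, `ρ + σ ≤ ρ₁∕2`: the walk enters `Z`, so its first leg is at least `d_Z(y)` long), ★ `hasMaj_outLoc_comp_exp`
  (an output-localized left factor keeps its `1_Z(y)` through a composition).
* §3 ★★★ **`hasMaj_glueInv_sub_glueInv`**: `G₀♭ ≤ Ae^{−δd}`, `R, R♭ ≤ θe^{−δd}`, `θc_r < 1`, `G₀ − G₀♭ ≤ 1_Z(y)·a₁e^{−δd}`, `R − R♭ ≤ 1_Z(y)·θ₁e^{−δd}`, `4σ ≤ δ` ⟹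
  `glueInv G₀ R − glueInv G₀♭ R♭ ≤ (a₁ + A(1 − θc_r)⁻¹c_r·θ₁·c_r)(1 − θc_r)⁻¹c_r · e^{−(δ∕2−σ)d_Z(y)} · e^{−(δ∕2−2σ)d(y,y′)}`.
* §4 ★★★ **`hasMaj_glueInv_sub_glueInv_of_pieces`** (cube level, FILE 45's currency): pieces `P_□, P♭_□ ≤ 1_{S_□}1_{S_□}·βe^{−δd}`, `Q_□, Q♭_□ ≤ 1_{S_□}1_{S_□}·θ₀e^{−δd}`, overlap `N_ov`,
  `N_ovθ₀c_r < 1`, `P_□ = P♭_□` and `Q_□ = Q♭_□` unless `Far □`, `S_□ ⊆ Z` when `Far □` ⟹ `glueInv (ΣP) (ΣQ) − glueInv (ΣP♭) (ΣQ♭) ≤ C·e^{−(δ∕2−σ)d_Z(y)}·e^{−(δ∕2−2σ)d}` with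
  `C = N_ov(2β + N_ovβ(1 − N_ovθ₀c_r)⁻¹c_r·2θ₀·c_r)(1 − N_ovθ₀c_r)⁻¹c_r`; ★★ `hasMaj_glued_sub_glued_of_cubes` (the `parametrix`∕`remainder` edition: cube propagators and commutator
  pieces agreeing off `Far`).

HONEST FRAMING ∕ LIMITS.  Operator algebra + block-majorant bookkeeping over FILE 43∕45's abstract glued inverse ([B9] Cor. 3.8 (3.94) p.410, Thm 3.14 pp.426–427, (3.95) p.411 =
MECHANISM; nothing of [B6]∕[B9] asserted); proves NO estimate of a concrete propagator — the site∕bond instantiations (`G′(U)` vs `G′(V)` for `U = V` off `Z` in the per-cube class) are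
the sequel.  NE2⁺ NOT PRINTED, NOT proved; N15 of record untouched (DISCHARGED AS CONSUMED, p687738); K3⁸ OPEN; counts of record UNMOVED (typed 28∕28 · discharged 8∕27); one finite 𝕋⁴
at fixed ε per index — NOT infinite volume, NOT OS on ℝ⁴, NOT a mass gap, NOT Clay.  Restate-immune (no Theses import).
-/

noncomputable section

namespace Summit.QuantumFields.YangMills.BalabanUVNodes.N15.Gluing

open Literature.MathematicalPhysics.QuantumFieldTheory.Balaban1983to89
open Literature.MathematicalPhysics.QuantumFieldTheory.Balaban1983to89.B11SectG (BlockNorm HasMaj RowSum hasMaj_comp hasMaj_comp_exp conv_exp_le hasMaj_zero)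
open Literature.MathematicalPhysics.QuantumFieldTheory.Balaban1983to89.B6RandomWalk (Triangle254)
open Literature.MathematicalPhysics.QuantumFieldTheory.Balaban1983to89.B6Prop26Gluing (mulOp mulOp_apply ind ind_nonneg ind_le_one ind_of_mem ind_of_not_mem)
open Literature.MathematicalPhysics.QuantumFieldTheory.Balaban1983to89.T4EtaRateCoeffDefect (diagK diagK_nonneg hasMaj_mulOp)

/-! ## §1 Algebra: the difference of two resummations, of two glued inverses -/

section Algebra

variable {X : Type} [Fintype X] [DecidableEq X]

/-- `N − N♭ = N∘(R − R♭)∘N♭` for the resummations `N = (1 − R)⁻¹`, `N♭ = (1 − R♭)⁻¹` (the second resolvent identity). [folklore] -/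
theorem neumannR_sub_neumannR {R R' : (X → ℝ) →ₗ[ℝ] (X → ℝ)} (hunit : IsUnit (1 - LinearMap.toMatrix' R)) (hunit' : IsUnit (1 - LinearMap.toMatrix' R')) :
    neumannR R - neumannR R' = neumannR R ∘ₗ (R - R') ∘ₗ neumannR R' := by
  have h1 : neumannR R = (neumannR R ∘ₗ (LinearMap.id - R')) ∘ₗ neumannR R' := by
    rw [LinearMap.comp_assoc, one_sub_comp_neumannR hunit', LinearMap.comp_id]
  have h2 : neumannR R' = (neumannR R ∘ₗ (LinearMap.id - R)) ∘ₗ neumannR R' := by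
    rw [neumannR_comp_one_sub hunit, LinearMap.id_comp]
  calc neumannR R - neumannR R' = (neumannR R ∘ₗ (LinearMap.id - R')) ∘ₗ neumannR R' - (neumannR R ∘ₗ (LinearMap.id - R)) ∘ₗ neumannR R' := by rw [← h1, ← h2]
    _ = neumannR R ∘ₗ (R - R') ∘ₗ neumannR R' := by
        rw [← LinearMap.sub_comp, ← LinearMap.comp_sub, LinearMap.comp_assoc]
        congr 2
        abel

/-- ★ **THE DIFFERENCE OF TWO GLUED INVERSES**: `G₀N − G₀♭N♭ = (G₀ − G₀♭)∘N + G₀♭∘N∘(R − R♭)∘N♭` — no telescoping over walk lengths is needed, the resolvent identity of the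
resummation does it. [cite: Balaban1985BackgroundPropagators, Cor. 3.8 p.410 (mechanism); Balaban1984PropagatorsII, (2.91) p.239] -/
theorem glueInv_sub_glueInv {G₀ G₀' R R' : (X → ℝ) →ₗ[ℝ] (X → ℝ)} (hunit : IsUnit (1 - LinearMap.toMatrix' R)) (hunit' : IsUnit (1 - LinearMap.toMatrix' R')) :
    glueInv G₀ R - glueInv G₀' R' = (G₀ - G₀') ∘ₗ neumannR R + G₀' ∘ₗ (neumannR R ∘ₗ (R - R') ∘ₗ neumannR R') := by
  rw [← neumannR_sub_neumannR hunit hunit', glueInv_def, glueInv_def, LinearMap.sub_comp, LinearMap.comp_sub]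
  abel

end Algebra

/-! ## §2 Kernels: a walk that must enter `Z` pays `e^{−(ρ∕2)d_Z(y)}` on its first leg -/

section Kernels

variable {g : B6.Geometry} {F₁ F₂ F₃ : Type} [AddCommGroup F₁] [Module ℝ F₁] [AddCommGroup F₂] [Module ℝ F₂] [AddCommGroup F₃] [Module ℝ F₃]
  (Z : Set g.Site) (dZ : g.Site → ℝ)

/-- The first-leg split: for `z ∈ Z`, `e^{−ρd(y,z)} ≤ e^{−(ρ∕2)d_Z(y)}·e^{−(ρ∕2)d(y,z)}` (`ρ ≥ 0`, `d_Z(y) ≤ d(y,z)`). [folklore] -/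
theorem exp_far_split (hdZ : ∀ y z, z ∈ Z → dZ y ≤ g.dist y z) {ρ : ℝ} (hρ : 0 ≤ ρ) (y : g.Site) {z : g.Site} (hz : z ∈ Z) :
    Real.exp (-(ρ * g.dist y z)) ≤ Real.exp (-(ρ / 2 * dZ y)) * Real.exp (-(ρ / 2 * g.dist y z)) := by
  rw [← Real.exp_add]
  refine Real.exp_le_exp.mpr ?_
  have hρ2 : (0 : ℝ) ≤ ρ / 2 := by positivity
  have h := mul_le_mul_of_nonneg_left (hdZ y z hz) hρ2
  linarith

/-- `1_Z(y) ≤ e^{−c·d_Z(y)}` for `c ≥ 0` (on `Z` the minorant is `≤ d(y,y) = 0`). [folklore] -/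
theorem ind_le_exp_dZ (hd0 : ∀ y : g.Site, g.dist y y = 0) (hdZ : ∀ y z, z ∈ Z → dZ y ≤ g.dist y z) {c : ℝ} (hc : 0 ≤ c) (y : g.Site) :
    ind Z y ≤ Real.exp (-(c * dZ y)) := by
  by_cases hy : y ∈ Z
  · rw [ind_of_mem hy]
    have h0 : dZ y ≤ 0 := (hdZ y y hy).trans (le_of_eq (hd0 y))
    calc (1 : ℝ) = Real.exp 0 := Real.exp_zero.symm
      _ ≤ Real.exp (-(c * dZ y)) := Real.exp_le_exp.mpr (by nlinarith)
  · rw [ind_of_not_mem hy]; exact Real.exp_nonneg _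

variable {σ cr : ℝ}

/-- ★★ **THE FIRST LEG INTO `Z`**: `T₁ ≤ a₁e^{−ρ₁d}` after an OUTPUT-LOCALIZED `T₂ ≤ 1_Z(y)·a₂e^{−ρ₂d}` ⟹ `T₁∘T₂ ≤ κ₂a₁a₂c_r·e^{−(ρ₁∕2)d_Z(y)}·e^{−ρd(y,y′)}` for `0 ≤ ρ ≤ ρ₂`,
`ρ + σ ≤ ρ₁∕2` — the intermediate point lies in `Z`, at least `d_Z(y)` away from the output `y`. [cite: Balaban1985BackgroundPropagators, Cor. 3.8 (3.93)–(3.94) p.410 (mechanism)] -/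
theorem hasMaj_comp_farOut {b₁ : BlockNorm g F₁} {b₂ : BlockNorm g F₂} {b₃ : BlockNorm g F₃} {T₁ : F₂ →ₗ[ℝ] F₃} {T₂ : F₁ →ₗ[ℝ] F₂} {a₁ a₂ ρ₁ ρ₂ ρ : ℝ}
    (htri : Triangle254 g) (hd : ∀ a b : g.Site, 0 ≤ g.dist a b) (hrow : RowSum g σ cr) (hdZ : ∀ y z, z ∈ Z → dZ y ≤ g.dist y z)
    (ha₁ : 0 ≤ a₁) (ha₂ : 0 ≤ a₂) (hρ₁ : 0 ≤ ρ₁) (hρ : 0 ≤ ρ) (hρρ₂ : ρ ≤ ρ₂) (hρρ₁ : ρ + σ ≤ ρ₁ / 2)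
    (h₁ : HasMaj b₂ b₃ T₁ (fun y z => a₁ * Real.exp (-(ρ₁ * g.dist y z))))
    (h₂ : HasMaj b₁ b₂ T₂ (fun z y' => ind Z z * (a₂ * Real.exp (-(ρ₂ * g.dist z y'))))) :
    HasMaj b₁ b₃ (T₁ ∘ₗ T₂) (fun y y' => b₂.κ * a₁ * a₂ * cr * Real.exp (-(ρ₁ / 2 * dZ y)) * Real.exp (-(ρ * g.dist y y'))) := by
  refine (hasMaj_comp h₁ h₂ fun a b => mul_nonneg ha₁ (Real.exp_nonneg _)).mono fun y y' => ?_
  have hterm : ∀ z : g.Site, a₁ * Real.exp (-(ρ₁ * g.dist y z)) * (b₂.κ * (ind Z z * (a₂ * Real.exp (-(ρ₂ * g.dist z y'))))) ≤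
      b₂.κ * a₁ * a₂ * Real.exp (-(ρ₁ / 2 * dZ y)) * (Real.exp (-(ρ₁ / 2 * g.dist y z)) * Real.exp (-(ρ₂ * g.dist z y'))) := by
    intro z
    by_cases hz : z ∈ Z
    · rw [ind_of_mem hz, one_mul]
      have hs := exp_far_split Z dZ hdZ hρ₁ y hz
      have hc : 0 ≤ b₂.κ * a₁ * a₂ * Real.exp (-(ρ₂ * g.dist z y')) := by
        have := b₂.κ_nonneg; positivity
      calc a₁ * Real.exp (-(ρ₁ * g.dist y z)) * (b₂.κ * (a₂ * Real.exp (-(ρ₂ * g.dist z y'))))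
          = (b₂.κ * a₁ * a₂ * Real.exp (-(ρ₂ * g.dist z y'))) * Real.exp (-(ρ₁ * g.dist y z)) := by ring
        _ ≤ (b₂.κ * a₁ * a₂ * Real.exp (-(ρ₂ * g.dist z y'))) * (Real.exp (-(ρ₁ / 2 * dZ y)) * Real.exp (-(ρ₁ / 2 * g.dist y z))) := mul_le_mul_of_nonneg_left hs hc
        _ = _ := by ring
    · rw [ind_of_not_mem hz, zero_mul, mul_zero, mul_zero]
      have := b₂.κ_nonneg; positivity
  have hconv := conv_exp_le (ρ₁ := ρ₁ / 2) (ρ₂ := ρ₂) (ρ := ρ) htri hd hrow hρ hρρ₂ hρρ₁ y y'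
  have hc0 : 0 ≤ b₂.κ * a₁ * a₂ * Real.exp (-(ρ₁ / 2 * dZ y)) := by have := b₂.κ_nonneg; positivity
  calc ∑ z : g.Site, a₁ * Real.exp (-(ρ₁ * g.dist y z)) * (b₂.κ * (ind Z z * (a₂ * Real.exp (-(ρ₂ * g.dist z y')))))
      ≤ ∑ z : g.Site, b₂.κ * a₁ * a₂ * Real.exp (-(ρ₁ / 2 * dZ y)) * (Real.exp (-(ρ₁ / 2 * g.dist y z)) * Real.exp (-(ρ₂ * g.dist z y'))) := Finset.sum_le_sum fun z _ => hterm z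
    _ = b₂.κ * a₁ * a₂ * Real.exp (-(ρ₁ / 2 * dZ y)) * ∑ z : g.Site, Real.exp (-(ρ₁ / 2 * g.dist y z)) * Real.exp (-(ρ₂ * g.dist z y')) := by rw [Finset.mul_sum]
    _ ≤ b₂.κ * a₁ * a₂ * Real.exp (-(ρ₁ / 2 * dZ y)) * (cr * Real.exp (-(ρ * g.dist y y'))) := mul_le_mul_of_nonneg_left hconv hc0
    _ = _ := by ring

/-- ★ An OUTPUT-LOCALIZED left factor keeps its indicator through a composition: `T₁ ≤ 1_Z(y)·a₁e^{−ρ₁d}`, `T₂ ≤ a₂e^{−ρ₂d}` ⟹ `T₁∘T₂ ≤ 1_Z(y)·κ₂a₁a₂c_r·e^{−ρd}` (`0 ≤ ρ ≤ ρ₂`,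
`ρ + σ ≤ ρ₁`). [folklore] -/
theorem hasMaj_outLoc_comp_exp {b₁ : BlockNorm g F₁} {b₂ : BlockNorm g F₂} {b₃ : BlockNorm g F₃} {T₁ : F₂ →ₗ[ℝ] F₃} {T₂ : F₁ →ₗ[ℝ] F₂} {a₁ a₂ ρ₁ ρ₂ ρ : ℝ}
    (htri : Triangle254 g) (hd : ∀ a b : g.Site, 0 ≤ g.dist a b) (hrow : RowSum g σ cr) (ha₁ : 0 ≤ a₁) (ha₂ : 0 ≤ a₂) (hρ : 0 ≤ ρ) (hρρ₂ : ρ ≤ ρ₂) (hρρ₁ : ρ + σ ≤ ρ₁)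
    (h₁ : HasMaj b₂ b₃ T₁ (fun y z => ind Z y * (a₁ * Real.exp (-(ρ₁ * g.dist y z)))))
    (h₂ : HasMaj b₁ b₂ T₂ (fun z y' => a₂ * Real.exp (-(ρ₂ * g.dist z y')))) :
    HasMaj b₁ b₃ (T₁ ∘ₗ T₂) (fun y y' => ind Z y * (b₂.κ * a₁ * a₂ * cr * Real.exp (-(ρ * g.dist y y')))) := by
  refine (hasMaj_comp h₁ h₂ fun a b => mul_nonneg (ind_nonneg _ _) (mul_nonneg ha₁ (Real.exp_nonneg _))).mono fun y y' => ?_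
  have hconv := conv_exp_le (ρ₁ := ρ₁) (ρ₂ := ρ₂) (ρ := ρ) htri hd hrow hρ hρρ₂ hρρ₁ y y'
  have hc0 : 0 ≤ ind Z y * (b₂.κ * a₁ * a₂) := by have := b₂.κ_nonneg; have := ind_nonneg Z y; positivity
  calc ∑ z : g.Site, ind Z y * (a₁ * Real.exp (-(ρ₁ * g.dist y z))) * (b₂.κ * (a₂ * Real.exp (-(ρ₂ * g.dist z y'))))
      = ind Z y * (b₂.κ * a₁ * a₂) * ∑ z : g.Site, Real.exp (-(ρ₁ * g.dist y z)) * Real.exp (-(ρ₂ * g.dist z y')) := by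
        rw [Finset.mul_sum]; exact Finset.sum_congr rfl fun z _ => by ring
    _ ≤ ind Z y * (b₂.κ * a₁ * a₂) * (cr * Real.exp (-(ρ * g.dist y y'))) := mul_le_mul_of_nonneg_left hconv hc0
    _ = _ := by ring

end Kernels

/-! ## §3 The walk locality of glued inverses -/

section Locality

variable {X : Type} [Fintype X] [DecidableEq X] {g : B6.Geometry} (blk : X → g.Site) (Z : Set g.Site) (dZ : g.Site → ℝ) {σ cr : ℝ}

/-- ★★★ **THE WALK LOCALITY OF GLUED INVERSES.**  Two parametrix pairs with `G₀♭ ≤ Ae^{−δd}`, `R, R♭ ≤ θe^{−δd}`, `θc_r < 1`, whose differences are OUTPUT-LOCALIZED on `Z`: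
`G₀ − G₀♭ ≤ 1_Z(y)·a₁e^{−δd}`, `R − R♭ ≤ 1_Z(y)·θ₁e^{−δd}` (bounded, NOT small), and a minorant `d_Z` of the distance to `Z`.  Then, with `4σ ≤ δ`,
`glueInv G₀ R − glueInv G₀♭ R♭ ≤ (a₁ + A(1 − θc_r)⁻¹c_r·θ₁·c_r)·(1 − θc_r)⁻¹c_r · e^{−(δ∕2−σ)d_Z(y)} · e^{−(δ∕2−2σ)d(y,y′)}` — every walk of the difference visits `Z`.
[cite: Balaban1985BackgroundPropagators, Cor. 3.8 (3.93)–(3.94) p.410, Thm 3.14 pp.426–427 (mechanism); Balaban1984PropagatorsII, (2.91) p.239, (2.135)–(2.136) p.247] -/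
theorem hasMaj_glueInv_sub_glueInv (htri : Triangle254 g) (hd : ∀ a b : g.Site, 0 ≤ g.dist a b) (hd0 : ∀ y : g.Site, g.dist y y = 0) (hrow : RowSum g σ cr) (hσ : 0 ≤ σ)
    (hcr : 0 ≤ cr) (hdZ : ∀ y z, z ∈ Z → dZ y ≤ g.dist y z) {G₀ G₀' R R' : (X → ℝ) →ₗ[ℝ] (X → ℝ)} {A θ a₁ θ₁ δ : ℝ} (hA : 0 ≤ A) (hθ : 0 ≤ θ) (ha₁ : 0 ≤ a₁) (hθ₁ : 0 ≤ θ₁)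
    (hσδ : 4 * σ ≤ δ)
    (hG₀' : HasMaj (BlockNorm.ofBlocks g blk) (BlockNorm.ofBlocks g blk) G₀' (fun y y' => A * Real.exp (-(δ * g.dist y y'))))
    (hR : HasMaj (BlockNorm.ofBlocks g blk) (BlockNorm.ofBlocks g blk) R (fun y y' => θ * Real.exp (-(δ * g.dist y y'))))
    (hR' : HasMaj (BlockNorm.ofBlocks g blk) (BlockNorm.ofBlocks g blk) R' (fun y y' => θ * Real.exp (-(δ * g.dist y y'))))
    (hdG : HasMaj (BlockNorm.ofBlocks g blk) (BlockNorm.ofBlocks g blk) (G₀ - G₀') (fun y y' => ind Z y * (a₁ * Real.exp (-(δ * g.dist y y')))))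
    (hdR : HasMaj (BlockNorm.ofBlocks g blk) (BlockNorm.ofBlocks g blk) (R - R') (fun y y' => ind Z y * (θ₁ * Real.exp (-(δ * g.dist y y')))))
    (hq : θ * cr < 1) :
    HasMaj (BlockNorm.ofBlocks g blk) (BlockNorm.ofBlocks g blk) (glueInv G₀ R - glueInv G₀' R')
      (fun y y' => (a₁ + A * ((1 - θ * cr)⁻¹ * cr) * θ₁ * cr) * ((1 - θ * cr)⁻¹ * cr) * Real.exp (-((δ / 2 - σ) * dZ y)) * Real.exp (-((δ / 2 - 2 * σ) * g.dist y y'))) := by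
  have hκ : (BlockNorm.ofBlocks g blk).κ = 1 := rfl
  have hσδ' : σ ≤ δ := by linarith
  have hinv : 0 ≤ (1 - θ * cr)⁻¹ := inv_nonneg.2 (by linarith)
  have hunit := isUnit_neumannR blk hd hrow hθ hσδ' hR hq
  have hunit' := isUnit_neumannR blk hd hrow hθ hσδ' hR' hq
  -- the resummations decay at rate `δ − σ`
  have hN := hasMaj_neumannR blk htri hd hd0 hrow (ρ := δ - σ) hθ (by linarith) (by linarith) hR hq
  have hN' := hasMaj_neumannR blk htri hd hd0 hrow (ρ := δ - σ) hθ (by linarith) (by linarith) hR' hq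
  -- term 1: `(G₀ − G₀♭)∘N ≤ 1_Z(y)·a₁(1 − θc_r)⁻¹c_r·e^{−(δ−2σ)d}`
  have h1 := hasMaj_outLoc_comp_exp Z (ρ₁ := δ) (ρ₂ := δ - σ) (ρ := δ - 2 * σ) htri hd hrow ha₁ hinv (by linarith) (by linarith) (by linarith) hdG hN
  -- term 2: `(G₀♭∘N)∘((R − R♭)∘N♭)` — the first leg into `Z`
  have h2a := hasMaj_comp_exp (b₁ := BlockNorm.ofBlocks g blk) (b₂ := BlockNorm.ofBlocks g blk) (b₃ := BlockNorm.ofBlocks g blk) (T₁ := G₀') (T₂ := neumannR R)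
    (ρ := δ - 2 * σ) htri hd hrow hA hinv (by linarith) (by linarith) (by linarith) hG₀' hN
  have h2b := hasMaj_outLoc_comp_exp Z (ρ₁ := δ) (ρ₂ := δ - σ) (ρ := δ - 2 * σ) htri hd hrow hθ₁ hinv (by linarith) (by linarith) (by linarith) hdR hN'
  have h2 := hasMaj_comp_farOut Z dZ (b₁ := BlockNorm.ofBlocks g blk) (b₂ := BlockNorm.ofBlocks g blk) (b₃ := BlockNorm.ofBlocks g blk) (T₁ := G₀' ∘ₗ neumannR R)
    (T₂ := (R - R') ∘ₗ neumannR R') (ρ₁ := δ - 2 * σ) (ρ₂ := δ - 2 * σ) (ρ := δ / 2 - 2 * σ) htri hd hrow hdZ (by rw [hκ]; positivity) (by rw [hκ]; positivity) (by linarith)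
    (by linarith) (by linarith) (by linarith) h2a h2b
  rw [glueInv_sub_glueInv hunit hunit']
  refine ((h1.add h2).congr fun μ => rfl).mono fun y y' => ?_
  rw [hκ]
  have hE1 : Real.exp (-((δ - 2 * σ) * g.dist y y')) ≤ Real.exp (-((δ / 2 - 2 * σ) * g.dist y y')) :=
    Real.exp_le_exp.mpr (by nlinarith [hd y y'])
  have hE2 : Real.exp (-((δ - 2 * σ) / 2 * dZ y)) = Real.exp (-((δ / 2 - σ) * dZ y)) := by ring_nf
  have hI : ind Z y ≤ Real.exp (-((δ / 2 - σ) * dZ y)) := ind_le_exp_dZ Z dZ hd0 hdZ (by linarith) y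
  have hx0 : 0 ≤ Real.exp (-((δ / 2 - σ) * dZ y)) := Real.exp_nonneg _
  have hy0 : 0 ≤ Real.exp (-((δ / 2 - 2 * σ) * g.dist y y')) := Real.exp_nonneg _
  have hz0 : 0 ≤ Real.exp (-((δ - 2 * σ) * g.dist y y')) := Real.exp_nonneg _
  have hc1 : 0 ≤ 1 * a₁ * (1 - θ * cr)⁻¹ * cr := by positivity
  have hc2 : 0 ≤ 1 * (1 * A * (1 - θ * cr)⁻¹ * cr) * (1 * θ₁ * (1 - θ * cr)⁻¹ * cr) * cr := by positivity
  rw [hE2]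
  calc ind Z y * (1 * a₁ * (1 - θ * cr)⁻¹ * cr * Real.exp (-((δ - 2 * σ) * g.dist y y'))) +
        1 * (1 * A * (1 - θ * cr)⁻¹ * cr) * (1 * θ₁ * (1 - θ * cr)⁻¹ * cr) * cr * Real.exp (-((δ / 2 - σ) * dZ y)) * Real.exp (-((δ / 2 - 2 * σ) * g.dist y y'))
      ≤ Real.exp (-((δ / 2 - σ) * dZ y)) * (1 * a₁ * (1 - θ * cr)⁻¹ * cr * Real.exp (-((δ / 2 - 2 * σ) * g.dist y y'))) +
        1 * (1 * A * (1 - θ * cr)⁻¹ * cr) * (1 * θ₁ * (1 - θ * cr)⁻¹ * cr) * cr * Real.exp (-((δ / 2 - σ) * dZ y)) * Real.exp (-((δ / 2 - 2 * σ) * g.dist y y')) := by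
        gcongr
    _ = _ := by ring

end Locality

/-! ## §4 The cube-level editions: pieces agreeing off the far cubes -/

section Pieces

variable {X : Type} [Fintype X] [DecidableEq X] {ι : Type} [Fintype ι] {g : B6.Geometry} (blk : X → g.Site) (S : ι → Set g.Site) (Far : ι → Prop) [DecidablePred Far]
  (Z : Set g.Site) (dZ : g.Site → ℝ) {σ cr : ℝ}

omit [DecidableEq X] in
/-- A sum of two-sided cube-localized pieces, vanishing off the far cubes whose reaches lie in `Z`, is OUTPUT-LOCALIZED on `Z` with the overlap constant:
`Σ_□ D_□ ≤ 1_Z(y)·N_ov·c·e^{−δd}` when `D_□ ≤ 1_{S_□}1_{S_□}·ce^{−δd}`, `D_□ = 0` unless `Far □`, `S_□ ⊆ Z` for `Far □`. [folklore] -/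
theorem hasMaj_sum_far {Nov : ℝ} (hN : ∀ a, ∑ i, ind (S i) a ≤ Nov) (hZ : ∀ i, Far i → S i ⊆ Z) {D : ι → (X → ℝ) →ₗ[ℝ] (X → ℝ)} {c δ : ℝ} (hc : 0 ≤ c)
    (hD : ∀ i, HasMaj (BlockNorm.ofBlocks g blk) (BlockNorm.ofBlocks g blk) (D i) (fun y y' => ind (S i) y * ind (S i) y' * (c * Real.exp (-(δ * g.dist y y')))))
    (hD0 : ∀ i, ¬Far i → D i = 0) :
    HasMaj (BlockNorm.ofBlocks g blk) (BlockNorm.ofBlocks g blk) (∑ i, D i) (fun y y' => ind Z y * (Nov * c * Real.exp (-(δ * g.dist y y')))) := by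
  have hterm : ∀ i, HasMaj (BlockNorm.ofBlocks g blk) (BlockNorm.ofBlocks g blk) (D i) (fun y y' => ind (S i) y * (ind Z y * (c * Real.exp (-(δ * g.dist y y'))))) := by
    intro i
    by_cases hi : Far i
    · refine (hD i).mono fun y y' => ?_
      have hE : 0 ≤ c * Real.exp (-(δ * g.dist y y')) := mul_nonneg hc (Real.exp_nonneg _)
      by_cases hy : y ∈ S i
      · rw [ind_of_mem hy, ind_of_mem (hZ i hi hy)]
        simp only [one_mul]
        exact mul_le_of_le_one_left hE (ind_le_one _ _)
      · rw [ind_of_not_mem hy, zero_mul, zero_mul, zero_mul]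
    · rw [hD0 i hi]
      exact (hasMaj_zero _ _).mono fun y y' => mul_nonneg (ind_nonneg _ _) (mul_nonneg (ind_nonneg _ _) (mul_nonneg hc (Real.exp_nonneg _)))
  refine (hasMaj_sum_overlap _ S _ Nov (fun y y' => mul_nonneg (ind_nonneg _ _) (mul_nonneg hc (Real.exp_nonneg _))) hterm hN).mono fun y y' => le_of_eq ?_
  ring

/-- ★★★ **WALK LOCALITY, CUBE PIECES**: `G₀ = Σ_□P_□`, `R = Σ_□Q_□` and `G₀♭ = Σ_□P♭_□`, `R♭ = Σ_□Q♭_□` with the (2.133)∕(2.134)-shaped rows `P_□, P♭_□ ≤ 1_{S_□}1_{S_□}·βe^{−δd}`,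
`Q_□, Q♭_□ ≤ 1_{S_□}1_{S_□}·θ₀e^{−δd}`, overlap `N_ov`, ONE smallness `N_ovθ₀c_r < 1`, `4σ ≤ δ`; the pieces AGREE on every cube not `Far`, and `S_□ ⊆ Z` for the far cubes.  Then
`glueInv G₀ R − glueInv G₀♭ R♭ ≤ N_ov(2β + N_ovβ(1 − N_ovθ₀c_r)⁻¹c_r·2θ₀·c_r)(1 − N_ovθ₀c_r)⁻¹c_r · e^{−(δ∕2−σ)d_Z(y)} · e^{−(δ∕2−2σ)d(y,y′)}`.
[cite: Balaban1985BackgroundPropagators, Cor. 3.8 (3.94) p.410, Thm 3.14 pp.426–427 (mechanism); Balaban1984PropagatorsII, (2.133)–(2.136) p.247] -/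
theorem hasMaj_glueInv_sub_glueInv_of_pieces (htri : Triangle254 g) (hd : ∀ a b : g.Site, 0 ≤ g.dist a b) (hd0 : ∀ y : g.Site, g.dist y y = 0) (hrow : RowSum g σ cr)
    (hσ : 0 ≤ σ) (hcr : 0 ≤ cr) (hdZ : ∀ y z, z ∈ Z → dZ y ≤ g.dist y z) {Nov : ℝ} (hN : ∀ a, ∑ i, ind (S i) a ≤ Nov) (hNov : 0 ≤ Nov) (hZ : ∀ i, Far i → S i ⊆ Z)
    {P P' Q Q' : ι → (X → ℝ) →ₗ[ℝ] (X → ℝ)} {β θ₀ δ : ℝ} (hβ : 0 ≤ β) (hθ : 0 ≤ θ₀) (hσδ : 4 * σ ≤ δ)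
    (hP : ∀ i, HasMaj (BlockNorm.ofBlocks g blk) (BlockNorm.ofBlocks g blk) (P i) (fun y y' => ind (S i) y * ind (S i) y' * (β * Real.exp (-(δ * g.dist y y')))))
    (hP' : ∀ i, HasMaj (BlockNorm.ofBlocks g blk) (BlockNorm.ofBlocks g blk) (P' i) (fun y y' => ind (S i) y * ind (S i) y' * (β * Real.exp (-(δ * g.dist y y')))))
    (hQ : ∀ i, HasMaj (BlockNorm.ofBlocks g blk) (BlockNorm.ofBlocks g blk) (Q i) (fun y y' => ind (S i) y * ind (S i) y' * (θ₀ * Real.exp (-(δ * g.dist y y')))))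
    (hQ' : ∀ i, HasMaj (BlockNorm.ofBlocks g blk) (BlockNorm.ofBlocks g blk) (Q' i) (fun y y' => ind (S i) y * ind (S i) y' * (θ₀ * Real.exp (-(δ * g.dist y y')))))
    (hPP' : ∀ i, ¬Far i → P i = P' i) (hQQ' : ∀ i, ¬Far i → Q i = Q' i) (hq : Nov * θ₀ * cr < 1) :
    HasMaj (BlockNorm.ofBlocks g blk) (BlockNorm.ofBlocks g blk) (glueInv (∑ i, P i) (∑ i, Q i) - glueInv (∑ i, P' i) (∑ i, Q' i))
      (fun y y' => (Nov * (2 * β) + Nov * β * ((1 - Nov * θ₀ * cr)⁻¹ * cr) * (Nov * (2 * θ₀)) * cr) * ((1 - Nov * θ₀ * cr)⁻¹ * cr) *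
        Real.exp (-((δ / 2 - σ) * dZ y)) * Real.exp (-((δ / 2 - 2 * σ) * g.dist y y'))) := by
  -- global rows of the primed pair and of `R`
  have hsumP' : HasMaj (BlockNorm.ofBlocks g blk) (BlockNorm.ofBlocks g blk) (∑ i, P' i) (fun y y' => Nov * β * Real.exp (-(δ * g.dist y y'))) := by
    have hterm : ∀ i, HasMaj (BlockNorm.ofBlocks g blk) (BlockNorm.ofBlocks g blk) (P' i) (fun y y' => ind (S i) y * (β * Real.exp (-(δ * g.dist y y')))) := fun i =>
      (hP' i).mono fun y y' => by
        have hE : 0 ≤ ind (S i) y * (β * Real.exp (-(δ * g.dist y y'))) := mul_nonneg (ind_nonneg _ _) (mul_nonneg hβ (Real.exp_nonneg _))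
        calc ind (S i) y * ind (S i) y' * (β * Real.exp (-(δ * g.dist y y'))) = ind (S i) y' * (ind (S i) y * (β * Real.exp (-(δ * g.dist y y')))) := by ring
          _ ≤ 1 * (ind (S i) y * (β * Real.exp (-(δ * g.dist y y')))) := mul_le_mul_of_nonneg_right (ind_le_one _ _) hE
          _ = _ := one_mul _
    refine (hasMaj_sum_overlap _ S _ Nov (fun y y' => mul_nonneg hβ (Real.exp_nonneg _)) hterm hN).mono fun y y' => le_of_eq (by ring)
  have hsumQ : ∀ {Qx : ι → (X → ℝ) →ₗ[ℝ] (X → ℝ)}, (∀ i, HasMaj (BlockNorm.ofBlocks g blk) (BlockNorm.ofBlocks g blk) (Qx i) (fun y y' => ind (S i) y * ind (S i) y' * (θ₀ * Real.exp (-(δ * g.dist y y'))))) →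
      HasMaj (BlockNorm.ofBlocks g blk) (BlockNorm.ofBlocks g blk) (∑ i, Qx i) (fun y y' => Nov * θ₀ * Real.exp (-(δ * g.dist y y'))) := by
    intro Qx hQx
    have hterm : ∀ i, HasMaj (BlockNorm.ofBlocks g blk) (BlockNorm.ofBlocks g blk) (Qx i) (fun y y' => ind (S i) y * (θ₀ * Real.exp (-(δ * g.dist y y')))) := fun i =>
      (hQx i).mono fun y y' => by
        have hE : 0 ≤ ind (S i) y * (θ₀ * Real.exp (-(δ * g.dist y y'))) := mul_nonneg (ind_nonneg _ _) (mul_nonneg hθ (Real.exp_nonneg _))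
        calc ind (S i) y * ind (S i) y' * (θ₀ * Real.exp (-(δ * g.dist y y'))) = ind (S i) y' * (ind (S i) y * (θ₀ * Real.exp (-(δ * g.dist y y')))) := by ring
          _ ≤ 1 * (ind (S i) y * (θ₀ * Real.exp (-(δ * g.dist y y')))) := mul_le_mul_of_nonneg_right (ind_le_one _ _) hE
          _ = _ := one_mul _
    refine (hasMaj_sum_overlap _ S _ Nov (fun y y' => mul_nonneg hθ (Real.exp_nonneg _)) hterm hN).mono fun y y' => le_of_eq (by ring)
  -- the differences are sums of far pieces
  have hdP : HasMaj (BlockNorm.ofBlocks g blk) (BlockNorm.ofBlocks g blk) (∑ i, P i - ∑ i, P' i) (fun y y' => ind Z y * (Nov * (2 * β) * Real.exp (-(δ * g.dist y y')))) := by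
    rw [← Finset.sum_sub_distrib]
    refine hasMaj_sum_far blk S Far Z hN hZ (D := fun i => P i - P' i) (c := 2 * β) (δ := δ) (by positivity) (fun i => ((hP i).sub (hP' i)).mono fun y y' => le_of_eq (by ring))
      fun i hi => ?_
    simp only [hPP' i hi, sub_self]
  have hdQ : HasMaj (BlockNorm.ofBlocks g blk) (BlockNorm.ofBlocks g blk) (∑ i, Q i - ∑ i, Q' i) (fun y y' => ind Z y * (Nov * (2 * θ₀) * Real.exp (-(δ * g.dist y y')))) := by
    rw [← Finset.sum_sub_distrib]
    refine hasMaj_sum_far blk S Far Z hN hZ (D := fun i => Q i - Q' i) (c := 2 * θ₀) (δ := δ) (by positivity) (fun i => ((hQ i).sub (hQ' i)).mono fun y y' => le_of_eq (by ring))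
      fun i hi => ?_
    simp only [hQQ' i hi, sub_self]
  exact hasMaj_glueInv_sub_glueInv blk Z dZ htri hd hd0 hrow hσ hcr hdZ (mul_nonneg hNov hβ) (mul_nonneg hNov hθ) (by positivity) (by positivity) hσδ hsumP' (hsumQ hQ) (hsumQ hQ')
    hdP hdQ hq

/-- ★★ **WALK LOCALITY FOR FILE 45's CUBE PAIRS**: two families of cube propagators `G_□, G♭_□` with partitions `h`, operators `Δ, Δ♭`, the (2.133)∕(2.134)-shaped rows for both, overlap
`N_ov`, `N_ovθ₀c_r < 1`, `4σ ≤ δ`, `|h_□| ≤ 1`; the cube propagators AND the commutator pieces `[Δ, M_{h_□}]∘G_□` agree off the far cubes (`S_□ ⊆ Z` there) ⟹ the glued propagators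
`glueInv (parametrix h G) (remainder Δ h G)` and `glueInv (parametrix h G♭) (remainder Δ♭ h G♭)` differ by `≤ C·e^{−(δ∕2−σ)d_Z(y)}·e^{−(δ∕2−2σ)d}` with §4's constant — «if we change
the domains outside some region, changes in the operator are exponentially small in the distance». [cite: Balaban1985BackgroundPropagators, Thm 3.14 pp.426–427, Cor. 3.8 p.410 (mechanism)] -/
theorem hasMaj_glued_sub_glued_of_cubes (htri : Triangle254 g) (hd : ∀ a b : g.Site, 0 ≤ g.dist a b) (hd0 : ∀ y : g.Site, g.dist y y = 0) (hrow : RowSum g σ cr) (hσ : 0 ≤ σ)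
    (hcr : 0 ≤ cr) (hdZ : ∀ y z, z ∈ Z → dZ y ≤ g.dist y z) {Nov : ℝ} (hN : ∀ a, ∑ i, ind (S i) a ≤ Nov) (hNov : 0 ≤ Nov) (hZ : ∀ i, Far i → S i ⊆ Z)
    {Δ Δ' : (X → ℝ) →ₗ[ℝ] (X → ℝ)} {h : ι → X → ℝ} {G G' : ι → (X → ℝ) →ₗ[ℝ] (X → ℝ)} {β θ₀ δ : ℝ} (hβ : 0 ≤ β) (hθ : 0 ≤ θ₀) (hσδ : 4 * σ ≤ δ) (hh : ∀ i x, |h i x| ≤ 1)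
    (hG : ∀ i, HasMaj (BlockNorm.ofBlocks g blk) (BlockNorm.ofBlocks g blk) (G i) (fun y y' => ind (S i) y * ind (S i) y' * (β * Real.exp (-(δ * g.dist y y')))))
    (hG' : ∀ i, HasMaj (BlockNorm.ofBlocks g blk) (BlockNorm.ofBlocks g blk) (G' i) (fun y y' => ind (S i) y * ind (S i) y' * (β * Real.exp (-(δ * g.dist y y')))))
    (hK : ∀ i, HasMaj (BlockNorm.ofBlocks g blk) (BlockNorm.ofBlocks g blk) (commOp Δ (h i) ∘ₗ G i) (fun y y' => ind (S i) y * ind (S i) y' * (θ₀ * Real.exp (-(δ * g.dist y y')))))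
    (hK' : ∀ i, HasMaj (BlockNorm.ofBlocks g blk) (BlockNorm.ofBlocks g blk) (commOp Δ' (h i) ∘ₗ G' i) (fun y y' => ind (S i) y * ind (S i) y' * (θ₀ * Real.exp (-(δ * g.dist y y')))))
    (hGG' : ∀ i, ¬Far i → G i = G' i) (hKK' : ∀ i, ¬Far i → commOp Δ (h i) ∘ₗ G i = commOp Δ' (h i) ∘ₗ G' i) (hq : Nov * θ₀ * cr < 1) :
    HasMaj (BlockNorm.ofBlocks g blk) (BlockNorm.ofBlocks g blk)
      (glueInv (parametrix h G) (remainder Δ h G) - glueInv (parametrix h G') (remainder Δ' h G'))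
      (fun y y' => (Nov * (2 * β) + Nov * β * ((1 - Nov * θ₀ * cr)⁻¹ * cr) * (Nov * (2 * θ₀)) * cr) * ((1 - Nov * θ₀ * cr)⁻¹ * cr) *
        Real.exp (-((δ / 2 - σ) * dZ y)) * Real.exp (-((δ / 2 - 2 * σ) * g.dist y y'))) := by
  -- the pieces: `P_□ = M_hG_□M_h`, `Q_□ = −[Δ, M_h]G_□M_h`
  have hPx : ∀ {Gx : ι → (X → ℝ) →ₗ[ℝ] (X → ℝ)}, (∀ i, HasMaj (BlockNorm.ofBlocks g blk) (BlockNorm.ofBlocks g blk) (Gx i) (fun y y' => ind (S i) y * ind (S i) y' * (β * Real.exp (-(δ * g.dist y y'))))) →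
      ∀ i, HasMaj (BlockNorm.ofBlocks g blk) (BlockNorm.ofBlocks g blk) (mulOp (h i) ∘ₗ Gx i ∘ₗ mulOp (h i)) (fun y y' => ind (S i) y * ind (S i) y' * (β * Real.exp (-(δ * g.dist y y')))) :=
    fun hGx i => hasMaj_mulOp_sandwich blk (fun y y' => mul_nonneg (mul_nonneg (ind_nonneg _ _) (ind_nonneg _ _)) (mul_nonneg hβ (Real.exp_nonneg _))) (hh i) (hh i) (hGx i)
  have hQx : ∀ {Δx : (X → ℝ) →ₗ[ℝ] (X → ℝ)} {Gx : ι → (X → ℝ) →ₗ[ℝ] (X → ℝ)},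
      (∀ i, HasMaj (BlockNorm.ofBlocks g blk) (BlockNorm.ofBlocks g blk) (commOp Δx (h i) ∘ₗ Gx i) (fun y y' => ind (S i) y * ind (S i) y' * (θ₀ * Real.exp (-(δ * g.dist y y'))))) →
      ∀ i, HasMaj (BlockNorm.ofBlocks g blk) (BlockNorm.ofBlocks g blk) (-((commOp Δx (h i) ∘ₗ Gx i) ∘ₗ mulOp (h i))) (fun y y' => ind (S i) y * ind (S i) y' * (θ₀ * Real.exp (-(δ * g.dist y y')))) := by
    intro Δx Gx hKx i
    have hMb := hasMaj_mulOp (g := g) blk (m := fun _ => (1 : ℝ)) (fun _ => zero_le_one) (hh i)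
    refine ((hasMaj_comp_diag blk (fun y y' => ?_) (hKx i) hMb).neg).mono fun y y' => le_of_eq (by ring)
    exact mul_nonneg (mul_nonneg (ind_nonneg _ _) (ind_nonneg _ _)) (mul_nonneg hθ (Real.exp_nonneg _))
  have hpar : ∀ (Gx : ι → (X → ℝ) →ₗ[ℝ] (X → ℝ)), parametrix h Gx = ∑ i, mulOp (h i) ∘ₗ Gx i ∘ₗ mulOp (h i) := fun _ => rfl
  have hrem : ∀ (Δx : (X → ℝ) →ₗ[ℝ] (X → ℝ)) (Gx : ι → (X → ℝ) →ₗ[ℝ] (X → ℝ)), remainder Δx h Gx = ∑ i, -((commOp Δx (h i) ∘ₗ Gx i) ∘ₗ mulOp (h i)) := by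
    intro Δx Gx
    rw [remainder, ← Finset.sum_neg_distrib]
    exact Finset.sum_congr rfl fun i _ => by rw [LinearMap.comp_assoc]
  rw [hpar G, hpar G', hrem Δ G, hrem Δ' G']
  refine hasMaj_glueInv_sub_glueInv_of_pieces blk S Far Z dZ htri hd hd0 hrow hσ hcr hdZ hN hNov hZ hβ hθ hσδ (hPx hG) (hPx hG') (hQx hK) (hQx hK') (fun i hi => ?_) (fun i hi => ?_) hq
  · rw [hGG' i hi]
  · rw [hKK' i hi]

end Pieces

end Summit.QuantumFields.YangMills.BalabanUVNodes.N15.Gluing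

end
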